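import Mathlib.NumberTheory.Harmonic.ZetaAsymp
import Mathlib.NumberTheory.LSeries.RiemannZeta
import Mathlib.Analysis.Normed.Module.FiniteDimension
import HarnessLib

/-!
# Local input for the smooth linear forms estimate (Conlon–Fox–Zhao §9): `ζ(s) = 1/(s-1) + O(1)`

Trunk T-SIEVE. The only property of the Riemann zeta function used in the elementary proof of the
smooth Goldston–Yıldırım linear forms estimate (D. Conlon, J. Fox, Y. Zhao, *The Green–Tao
theorem: an exposition*, arXiv:1403.2957, §9, p. 18, "Simple pole of Riemann zeta function. Here
is the argument showing that `ζ(s) = (s-1)^{-1} + O(1)` whenever `Re s > 1` and `s - 1 = O(1)`"):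
a uniform bound for `ζ(s) - 1/(s-1)` on the punctured disc `0 < |s - 1| ≤ 1` (no restriction to
`Re s > 1` is needed). Mathlib knows `ζ(s) - 1/(s-1) → γ` at `s = 1`
(`isBigO_riemannZeta_sub_one_div`) and that `ζ` is differentiable away from `1`; compactness of the
annulus `r/2 ≤ |s-1| ≤ 1` does the rest.

## References
* D. Conlon, J. Fox, Y. Zhao, EMS Surv. Math. Sci. 1 (2014), 249–282, §9 (p. 18).
  [cite: ConlonFoxZhao2014]
-/

noncomputable section

open Filter Topology Metric

namespace Literature.NumberTheory.Sieve.CFZ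

/-- **`ζ(s) = 1/(s-1) + O(1)` near `s = 1`** (CFZ §9, p. 18): there is `C` with
`|ζ(s) - 1/(s-1)| ≤ C` for all `s ≠ 1` with `|s - 1| ≤ 1`. [cite: ConlonFoxZhao2014, Section 9] -/
theorem exists_bound_riemannZeta_sub_one_div :
    ∃ C : ℝ, ∀ s : ℂ, s ≠ 1 → ‖s - 1‖ ≤ 1 → ‖riemannZeta s - 1 / (s - 1)‖ ≤ C := by
  set f : ℂ → ℂ := fun s => riemannZeta s - 1 / (s - 1) with hf
  -- near `1`: the `O(1)` bound of Mathlib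
  obtain ⟨C₁, hC₁⟩ := (isBigO_riemannZeta_sub_one_div (F := ℝ)).bound
  obtain ⟨r, hr, hball⟩ := Metric.eventually_nhds_iff.1 hC₁
  -- away from `1`: continuity on the compact annulus `r/2 ≤ |s-1| ≤ 1`
  set K : Set ℂ := {s | r / 2 ≤ ‖s - 1‖ ∧ ‖s - 1‖ ≤ 1} with hK_def
  have hKc : IsCompact K := by
    refine Metric.isCompact_of_isClosed_isBounded ?_ ?_
    · have hcont : Continuous fun s : ℂ => ‖s - 1‖ := (continuous_id.sub continuous_const).norm
      exact (isClosed_le continuous_const hcont).inter (isClosed_le hcont continuous_const)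
    · refine (Metric.isBounded_closedBall (x := (1 : ℂ)) (r := 1)).subset fun s hs => ?_
      rw [Metric.mem_closedBall, dist_eq_norm]; exact hs.2
  have hK1 : ∀ s ∈ K, s ≠ 1 := by
    intro s hs h
    have := hs.1
    rw [h, sub_self, norm_zero] at this
    linarith
  have hcont : ContinuousOn f K := by
    intro s hs
    have hs1 := hK1 s hs
    refine ContinuousAt.continuousWithinAt ?_
    exact ((differentiableAt_riemannZeta hs1).continuousAt).sub
      (continuousAt_const.div (continuousAt_id.sub continuousAt_const) (sub_ne_zero.2 hs1))
  obtain ⟨C₂, hC₂⟩ := hKc.exists_bound_of_continuousOn hcont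
  refine ⟨max (C₁ * ‖(1 : ℝ)‖) C₂, fun s hs1 hs => ?_⟩
  by_cases h : ‖s - 1‖ < r / 2
  · have hd : dist s 1 < r := by rw [dist_eq_norm]; linarith
    exact (hball hd).trans (le_max_left _ _)
  · exact (hC₂ s ⟨not_lt.1 h, hs⟩).trans (le_max_right _ _)

end Literature.NumberTheory.Sieve.CFZ
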